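import Summits.CriticalPhenomena.PercolationContinuityZ3.Theorems.PercFiniteBoxLRORenormaliseFromLinearLROStubBlockLawInputs

/-!
# Crux `PercFiniteBoxLRO.RenormaliseFromLinearLRO` (stmt-CriticalPhenomena-0857), line `registered`, reshape 3 —
# objects: SPINE BLOCKS (a coarse-graining whose dependence range does not grow with the LRO ratio `K`)

In reshape 2 the dense block of ratio `K` (objects file `…BlockDefs.lean`, p156138) is coarse-grained at spacing
`n = (2s+1)m` with regions `Λ(Kn)`, a `(2K+1)`-dependent planar field, so the criterion's threshold `δ(K)` decays with
`K` like a Peierls constant of a `(2K+1)`-dependent model.  Reshape 3 removes this: the SPINE BLOCK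
`spineBox K s m L` asks that ALL the `4L+2` windows `j·eᵢ` (`i ∈ {0,1}`, `|j| ≤ L`) of the planar layer of spacing `n`
be dense (`blockEvent n (denseBox K s m) (Pi.single i j)`); spine blocks are coarse-grained at spacing `L·n`.  For
`K ≤ L` the spine block is determined by the pairs inside `Λ(2Ln)` (`stub_spineLocal`, proved here), so the spine
field is `5`-dependent WHATEVER `K` is, while consecutive windows of a spine glue by the pigeonhole of reshape 2 and
the end window of a spine is the centre window of the neighbouring spine.  The price is a union bound: the spine fails
with probability `≤ (4L+2)·P(dense block fails)`.

Objects and plumbing: `relabel_shift_relabel_shift` (composition of configuration shifts), `blockCentre_add`,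
`blockCentre_mul`, `mem_blockEvent_blockEvent_iff` (a window of a translated block is a translated window),
`spineBox`, `mem_spineBox_iff`, `mem_blockEvent_spineBox_iff`, `measurableSet_spineBox`, and the registered stub
`stub_spineLocal`.  Lands `--supports stmt-CriticalPhenomena-0857`; later files of reshape 3 are definition-free.
-/

noncomputable section

namespace Summit.CriticalPhenomena.PercolationContinuityZ3.Theorems.RenormaliseFromLinearLRO

open Literature.Probability.Percolation Literature.Probability.LatticeModels
open MeasureTheory

/-! ## Composition of shifts and of block translations -/

/-- Shifting a configuration by `v` and then by `u` is shifting it by `v + u`. -/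
theorem relabel_shift_relabel_shift (u v : Site 3) (ω : BondConfig (Site 3)) :
    BondConfig.relabel (sym2Equiv (Site.shift u)) (BondConfig.relabel (sym2Equiv (Site.shift v)) ω) =
      BondConfig.relabel (sym2Equiv (Site.shift (v + u))) ω := by
  ext z
  induction z using Sym2.ind with
  | h x y =>
    have h1 := mk_add_mem_relabel_shift_iff u (BondConfig.relabel (sym2Equiv (Site.shift v)) ω) (x - u) (y - u)
    have h2 := mk_add_mem_relabel_shift_iff v ω (x - u - v) (y - u - v)
    have h3 := mk_add_mem_relabel_shift_iff (v + u) ω (x - u - v) (y - u - v)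
    simp only [sub_add_cancel] at h1 h2
    have e1 : x - u - v + (v + u) = x := by abel
    have e2 : y - u - v + (v + u) = y := by abel
    rw [e1, e2] at h3
    rw [h1, h2, h3]

/-- Block centres are additive in the block index. -/
theorem blockCentre_add (n : ℕ) (a b : Site 2) : blockCentre n (a + b) = blockCentre n a + blockCentre n b := by
  ext k
  fin_cases k <;> simp [blockCentre, mul_add]

/-- The centre of the block `a` at spacing `L·n` is the centre of the block `L·a` at spacing `n`. -/
theorem blockCentre_mul (L n : ℕ) (a : Site 2) :
    blockCentre (L * n) a = blockCentre n (fun k => (L : ℤ) * a k) := by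
  ext k
  fin_cases k <;> simp [blockCentre] <;> ring

/-- **A window of a translated block is a translated window**: translating (spacing `L·n`, index `a`) the block
event "the window `b` (spacing `n`) satisfies `E`" gives "the window `L·a + b` satisfies `E`". -/
theorem mem_blockEvent_blockEvent_iff (L n : ℕ) (E : Set (BondConfig (Site 3))) (a b : Site 2)
    (ω : BondConfig (Site 3)) :
    ω ∈ blockEvent (L * n) (blockEvent n E b) a ↔ ω ∈ blockEvent n E ((fun k => (L : ℤ) * a k) + b) := by
  simp only [blockEvent, Set.mem_preimage]
  rw [relabel_shift_relabel_shift, blockCentre_add, ← blockCentre_mul, neg_add]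

/-- The same, read on the shifted configuration: the configuration shifted by the centre of the block `a`
(spacing `L·n`) lies in "window `b` satisfies `E`" iff `ω` lies in "window `L·a + b` satisfies `E`". -/
theorem relabel_mem_blockEvent_iff (L n : ℕ) (E : Set (BondConfig (Site 3))) (a b : Site 2)
    (ω : BondConfig (Site 3)) :
    BondConfig.relabel (sym2Equiv (Site.shift (-blockCentre (L * n) a))) ω ∈ blockEvent n E b ↔
      ω ∈ blockEvent n E ((fun k => (L : ℤ) * a k) + b) := by
  simp only [blockEvent, Set.mem_preimage]
  rw [relabel_shift_relabel_shift, blockCentre_add, ← blockCentre_mul, neg_add]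

/-! ## The spine block -/

/-- **The spine block** `spineBox K s m L`: every window `j·eᵢ` of the planar layer of spacing `n = (2s+1)m` with
`i ∈ {0, 1}` and `|j| ≤ L` is a dense block `denseBox K s m` (translated to the window). -/
def spineBox (K s m L : ℕ) : Set (BondConfig (Site 3)) :=
  {ω | ∀ (i : Fin 2) (j : ℤ), |j| ≤ (L : ℤ) →
    ω ∈ blockEvent ((2 * s + 1) * m) (denseBox K s m) (Pi.single i j)}

/-- Membership in the spine block. -/
theorem mem_spineBox_iff {K s m L : ℕ} {ω : BondConfig (Site 3)} :
    ω ∈ spineBox K s m L ↔ ∀ (i : Fin 2) (j : ℤ), |j| ≤ (L : ℤ) →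
      ω ∈ blockEvent ((2 * s + 1) * m) (denseBox K s m) (Pi.single i j) := Iff.rfl

/-- The spine block as a countable intersection of translated dense blocks. -/
theorem spineBox_eq_iInter (K s m L : ℕ) :
    spineBox K s m L = ⋂ (i : Fin 2), ⋂ (j : ℤ), ⋂ (_ : |j| ≤ (L : ℤ)),
      blockEvent ((2 * s + 1) * m) (denseBox K s m) (Pi.single i j) := by
  ext ω
  simp only [spineBox, Set.mem_setOf_eq, Set.mem_iInter]

/-- **The translated spine block** (spacing `L·n`, index `a`) holds iff all the windows `L·a + j·eᵢ`, `|j| ≤ L`, of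
the layer of spacing `n` are dense. -/
theorem mem_blockEvent_spineBox_iff {K s m L : ℕ} {a : Site 2} {ω : BondConfig (Site 3)} :
    ω ∈ blockEvent (L * ((2 * s + 1) * m)) (spineBox K s m L) a ↔
      ∀ (i : Fin 2) (j : ℤ), |j| ≤ (L : ℤ) →
        ω ∈ blockEvent ((2 * s + 1) * m) (denseBox K s m) ((fun k => (L : ℤ) * a k) + Pi.single i j) := by
  simp only [blockEvent, Set.mem_preimage, mem_spineBox_iff, relabel_shift_relabel_shift, blockCentre_add,
    ← blockCentre_mul, neg_add]

/-- The spine block is measurable (`K ≥ 2`, `m ≥ 1`: the dense block is then measurable, being local). -/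
theorem measurableSet_spineBox {K s m : ℕ} (hK : 2 ≤ K) (hm : 1 ≤ m) (L : ℕ) :
    MeasurableSet (spineBox K s m L) := by
  rw [spineBox_eq_iInter]
  exact MeasurableSet.iInter fun i => MeasurableSet.iInter fun j => MeasurableSet.iInter fun _ =>
    measurableSet_blockEvent _ (stub_denseLocal K s m hK hm).measurableSet_of_finset _

/-! ## Locality of the spine block (the registered stub `stub_spineLocal` of the line) -/

/-- The pairs seen by the window `b` with `|blockCentre n b|_∞ ≤ L·n` and radius `K·n ≤ L·n` lie inside `Λ(2Ln)`. -/
theorem preimage_shift_sym2_subset {n K L : ℕ} (hKL : K ≤ L) {b : Site 2}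
    (hb : ∀ k : Fin 3, |blockCentre n b k| ≤ (L : ℤ) * n) :
    (sym2Equiv (Site.shift (-blockCentre n b))) ⁻¹' (↑((box 3 (K * n)).sym2) : Set (Sym2 (Site 3))) ⊆
      (↑((box 3 (2 * L * n)).sym2) : Set (Sym2 (Site 3))) := by
  intro e he
  rw [Set.mem_preimage, sym2Equiv_apply, Finset.coe_sym2] at he
  rw [Finset.coe_sym2]
  induction e using Sym2.ind with
  | h x y =>
    rw [Sym2.map_mk, Set.mk_mem_sym2_iff] at he
    rw [Set.mk_mem_sym2_iff]
    have key : ∀ z : Site 3, Site.shift (-blockCentre n b) z ∈ (↑(box 3 (K * n)) : Set (Site 3)) →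
        z ∈ (↑(box 3 (2 * L * n)) : Set (Site 3)) := by
      intro z hz
      rw [Finset.mem_coe, mem_box] at hz ⊢
      intro k
      have h1 := hz k
      have h2 := hb k
      simp only [Site.shift_apply, Pi.add_apply, Pi.neg_apply] at h1
      rw [abs_le] at h2
      have hKL' : (K : ℤ) * n ≤ L * n := by exact_mod_cast Nat.mul_le_mul_right n hKL
      push_cast at h1 h2 hKL' ⊢
      constructor <;> linarith [h1.1, h1.2, h2.1, h2.2]
    exact ⟨key x he.1, key y he.2⟩

/-- **Registered stub `stub_spineLocal` of crux stmt-CriticalPhenomena-0857 (line `registered`, reshape 3)**: for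
`2 ≤ K ≤ L` and `m ≥ 1`, the spine block is determined by the pairs inside `Λ(2Ln)`, `n = (2s+1)m` (each of its
windows `j·eᵢ`, `|j| ≤ L`, is a dense block of ratio `K`, determined by the pairs inside `j·n·eᵢ + Λ(Kn) ⊆ Λ(Ln + Kn)`). -/
theorem stub_spineLocal :
    ∀ (K s m L : ℕ), 2 ≤ K → 1 ≤ m → K ≤ L →
      DeterminedBy (spineBox K s m L)
        (↑((box 3 (2 * L * ((2 * s + 1) * m))).sym2) : Set (Sym2 (Site 3))) := by
  intro K s m L hK hm hKL
  rw [spineBox_eq_iInter]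
  refine DeterminedBy.iInter fun i => DeterminedBy.iInter fun j => DeterminedBy.iInter fun hj => ?_
  refine (blockEvent_determinedBy ((2 * s + 1) * m) (stub_denseLocal K s m hK hm) (Pi.single i j)).mono ?_
  set N : ℕ := (2 * s + 1) * m with hN
  have hn0 : (0 : ℤ) ≤ (N : ℤ) := by positivity
  have hjN : (N : ℤ) * |j| ≤ (L : ℤ) * N := by
    rw [mul_comm ((L : ℤ))]
    exact mul_le_mul_of_nonneg_left hj hn0
  have hall : ∀ k : Fin 3, |blockCentre N (Pi.single i j) k| ≤ (N : ℤ) * |j| := by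
    intro k
    have hnn : (0 : ℤ) ≤ (N : ℤ) * |j| := by positivity
    fin_cases i <;> fin_cases k <;> simp [blockCentre, abs_mul, abs_of_nonneg hn0, hnn]
  exact preimage_shift_sym2_subset hKL fun k => (hall k).trans hjN

end Summit.CriticalPhenomena.PercolationContinuityZ3.Theorems.RenormaliseFromLinearLRO

end
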